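import Summits.FinalStateConjecture.FinalStateConjecture.Theorems.StarvedNecksNeckGapDecayStubBandAnchoredPaths
import Summits.FinalStateConjecture.FinalStateConjecture.Theorems.StarvedNecksNeckGapDecayStubCertOfCore
import Literature.Geometry.Lorentzian.KerrWaveEnergy
import Literature.Geometry.Lorentzian.BackgroundChartCalculusFramed
import Literature.Geometry.Lorentzian.BilinPullbackEstimates
import Literature.Geometry.Lorentzian.KerrSchildEnergyEstimate
import Literature.Geometry.Lorentzian.BoostedKerrCausalLegs
import Literature.Geometry.Lorentzian.KerrHyperboloidalLeaves
import HarnessLib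

/-!
# Glue of the `NeckGapDecay` line `Sketch`: certificate bookkeeping over an arbitrary spacetime
# (crux `StarvedNecks.NeckGapDecay`, stmt-FinalStateConjecture-16768; `--supports`)

The sorry-free GLUE of the line skeleton `Cruxes/NeckGapDecay/Lines/Sketch.lean` (v1–v8, leads 0/c1), moved into the tree
(lead c3) so that the reduction of the crux to its physics core is an importable theorem (`…StarvedNecksNeckGapDecayOfCore`).
Elementary, over ANY `Spacetime.{0} 4` and ANY `C⁴` final-state decomposition (pointwise cone algebra at `r ≥ 100 M` is
the landed `Literature.Geometry.Lorentzian.BoostedKerrLegs.val_mfderiv_axis_le`); (G1) restricts to later thresholds (`g1_mono`); (G3) ⇒ eventual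
quantitative `C⁰` smallness (`eventually_c0_le`); **(G4) from the orientation anchor** (`g4_of_anchor`: S3a's band paths
`Literature.Geometry.Lorentzian.BandAnchoredPaths` + cone algebra + one sign on a preconnected set); **self-certified
walls** (`cert_of_selfCertified`: an input chart with `C²` deviation `→ 0` on the sub-wall slabs IS a `GapAnalyticCert`).
References: O'Neill 1983, Ch. 5 (Lemma 5.26), Ch. 14; DHRT arXiv:2104.08222, §1; Bartnik, CPAM 39 (1986), (1.3).
No definitions.
-/

noncomputable section

open scoped Manifold ContDiff Topology ENNReal
open Filter Set Topology Literature.Geometry.Lorentzian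

namespace Summit.FinalStateConjecture.FinalStateConjecture.Theorems.NeckGapDecay.ConnectionLevelCones.OfCoreGlue

open Summit.FinalStateConjecture.FinalStateConjecture.Theorems.NeckGapDecay.ConnectionLevelCones.CertOfCoreStub
  (GapAnalyticCert)

-- the problem namespace `Summit.FinalStateConjecture.FinalStateConjecture` repeats the summit name by design
set_option linter.dupNamespace false
-- instance search through nested operator types `E4 →L[ℝ] E4 →L[ℝ] ℝ`
set_option maxSynthPendingDepth 3

/-! ## Restriction in time, eventual `C⁰` smallness, orientation of the band, self-certified walls -/

section Glue

variable {𝓢 : Spacetime.{0} 4} {O : Set 𝓢.carrier}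

/-- Hole time `tᵢ = (Λᵢ⁻¹(x − cᵢ))⁰` is continuous on `E4`. [folklore] -/
theorem continuous_background_time (d : FinalStateDecomposition 𝓢 O 4) (i : Fin d.N) :
    Continuous (d.background i).time :=
  (PiLp.continuous_apply 2 _ 0).comp (continuous_poincareInv _ _)

/-- Hole radius `rᵢ = r(aᵢ, Λᵢ⁻¹(x − cᵢ))` is continuous on `E4`. [folklore] -/
theorem continuous_background_radius (d : FinalStateDecomposition 𝓢 O 4) (i : Fin d.N) :
    Continuous (d.background i).radius :=
  (Kerr.continuous_radius _).comp (continuous_poincareInv _ _)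

/-- The late sub-wall tube `{τ₁ < tᵢ, rᵢ < W(x⁰) + 1}` of a continuous wall is open in the domain. [folklore] -/
theorem isOpen_tube (d : FinalStateDecomposition 𝓢 O 4) (i : Fin d.N) (τ₁ : ℝ) {W : ℝ → ℝ}
    (hW : Continuous W) :
    IsOpen {x : (d.background i).domain |
      τ₁ < (d.background i).time x.1 ∧ (d.background i).radius x.1 < W (x.1 0) + 1} :=
  (isOpen_lt continuous_const ((continuous_background_time d i).comp continuous_subtype_val)).inter
    (isOpen_lt ((continuous_background_radius d i).comp continuous_subtype_val)
      ((hW.comp ((PiLp.continuous_apply 2 _ 0).comp continuous_subtype_val)).add continuous_const))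

/-- **Restriction of (G1) to a later time**: the late sub-wall tube from `τ₁' ≥ τ₁` is an open subset of the one
from `τ₁`, so smoothness, the open-embedding property and the image constraint restrict. [folklore] -/
theorem g1_mono (d : FinalStateDecomposition 𝓢 O 4) (i : Fin d.N) {τ₁ τ₁' : ℝ} (hτ : τ₁ ≤ τ₁') {W : ℝ → ℝ}
    (hW : Continuous W) (Ψg : (d.background i).domain → 𝓢.carrier)
    (hG1 : let B := d.background i;
      let U : Set B.domain := {x | τ₁ < B.time x.1 ∧ B.radius x.1 < W (x.1 0) + 1};
      ContMDiffOn 𝓘(ℝ, E4) (𝓡 4) ∞ Ψg U ∧ Topology.IsOpenEmbedding (U.restrict Ψg) ∧ Ψg '' U ⊆ d.charted) :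
    let B := d.background i;
    let U : Set B.domain := {x | τ₁' < B.time x.1 ∧ B.radius x.1 < W (x.1 0) + 1};
    ContMDiffOn 𝓘(ℝ, E4) (𝓡 4) ∞ Ψg U ∧ Topology.IsOpenEmbedding (U.restrict Ψg) ∧ Ψg '' U ⊆ d.charted := by
  intro B U
  obtain ⟨h1, h2, h3⟩ := hG1
  set U₀ : Set B.domain := {x | τ₁ < B.time x.1 ∧ B.radius x.1 < W (x.1 0) + 1} with hU₀
  have hsub : U ⊆ U₀ := fun x hx ↦ ⟨lt_of_le_of_lt hτ hx.1, hx.2⟩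
  refine ⟨h1.mono hsub, ?_, (image_mono hsub).trans h3⟩
  have hι : Topology.IsOpenEmbedding (Set.inclusion hsub) := by
    refine Topology.IsOpenEmbedding.of_comp _ (isOpen_tube d i τ₁ hW).isOpenEmbedding_subtypeVal ?_
    exact (isOpen_tube d i τ₁' hW).isOpenEmbedding_subtypeVal
  have hcomp : U.restrict Ψg = U₀.restrict Ψg ∘ Set.inclusion hsub := by
    funext x; rfl
  rw [hcomp]
  exact h2.comp hι

/-- **(G3) ⇒ eventual quantitative `C⁰` smallness**: if the `C²` sup-deviation on the slabs tends to `0`, then for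
every `c > 0` the `C⁰` sup-deviation on the slabs is eventually `≤ c` (`C⁰ ≤ C²` sup norms). [folklore] -/
theorem eventually_c0_le (d : FinalStateDecomposition 𝓢 O 4) (i : Fin d.N) (W : ℝ → ℝ)
    (Ψg : (d.background i).domain → 𝓢.carrier)
    (hG3 : Tendsto (fun τ ↦ supCkENorm (Subtype.val '' {x : (d.background i).domain |
      (d.background i).time x.1 = τ ∧ (d.background i).radius x.1 ≤ W (x.1 0)}) 2
      (𝓢.deviationExtend (d.background i) Ψg)) atTop (𝓝 0)) {c : ℝ} (hc : 0 < c) :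
    ∃ τq : ℝ, ∀ τ, τq ≤ τ → supCkENorm (Subtype.val '' {x : (d.background i).domain |
      (d.background i).time x.1 = τ ∧ (d.background i).radius x.1 ≤ W (x.1 0)}) 0
      (𝓢.deviationExtend (d.background i) Ψg) ≤ ENNReal.ofReal c := by
  have hpos : (0 : ℝ≥0∞) < ENNReal.ofReal c := ENNReal.ofReal_pos.2 hc
  have hev := (ENNReal.tendsto_nhds_zero.1 hG3) _ hpos
  obtain ⟨τq, hτq⟩ := eventually_atTop.1 hev
  exact ⟨τq, fun τ hτ ↦ (supCkENorm_mono_right _ (by norm_num) _).trans (hτq τ hτ)⟩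

/-- **(G4) from the orientation anchor** (v3 glue).  On hole `i`'s background, let `Ψg` be smooth on the late
sub-wall tube from `τ₁`, equal to the input chart `Ψᵢ` inside `R₁+1`, with `C⁰` deviation `≤ 1/(20‖Λᵢ‖²)` on the
slabs `{t = τ, r ≤ W(x⁰)}` for `τ ≥ τq`, and let `dΨᵢ(Λᵢe₀)` be future-directed on `{T ≤ t, R₀ ≤ r ≤ R₁+1}`.
Then for `τs > τ₁`, `τs ≥ τq`, `τs ≥ T`, the `Λᵢe₀`-lines of `Ψg` are future-directed on the band
`{τs ≤ t, R₁ ≤ r ≤ W(x⁰)}`: inside `R₁+½` because `Ψg = Ψᵢ` near the point; beyond, because the push-forward is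
timelike at every point of the band (cone algebra, `r ≥ R₀ ≥ 100Mᵢ`), S3a joins the point inside the band to the
collar sphere `{r = R₁+½}` by a preconnected set, and a continuous causal field on a preconnected set has one
time-orientation (`isFutureDirected_mfderiv_apply_of_isPreconnected`). O'Neill 1983, Ch. 5, Lemma 5.26 ff.
[folklore] -/
theorem g4_of_anchor (hS3a : Literature.Geometry.Lorentzian.BandAnchoredPaths) (d : FinalStateDecomposition 𝓢 O 4) {R₀ : ℝ} (i : Fin d.N)
    (hMR : 100 * d.mass i ≤ R₀) (hv : 0 < ((d.motion i).1 : E4 ≃L[ℝ] E4) (E4.basisVector 0) 0)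
    {R₁ τ₁ τq T τs : ℝ} (hR : R₀ ≤ R₁) {W : ℝ → ℝ} (hWc : Continuous W) (hWm : Monotone W)
    (Ψg : (d.background i).domain → 𝓢.carrier)
    (hG1 : ContMDiffOn 𝓘(ℝ, E4) (𝓡 4) ∞ Ψg {x : (d.background i).domain |
      τ₁ < (d.background i).time x.1 ∧ (d.background i).radius x.1 < W (x.1 0) + 1})
    (hG2 : ∀ x : (d.background i).domain, (d.background i).radius x.1 ≤ R₁ + 1 → Ψg x = d.chart i x)
    (hG3q : ∀ τ, τq ≤ τ → supCkENorm (Subtype.val '' {x : (d.background i).domain |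
      (d.background i).time x.1 = τ ∧ (d.background i).radius x.1 ≤ W (x.1 0)}) 0
      (𝓢.deviationExtend (d.background i) Ψg) ≤
        ENNReal.ofReal (1 / (20 * ‖(((d.motion i).1 : E4 ≃L[ℝ] E4) : E4 →L[ℝ] E4)‖ ^ 2)))
    (hT : ∀ x : (d.background i).domain, T ≤ (d.background i).time x.1 → R₀ ≤ (d.background i).radius x.1 →
      (d.background i).radius x.1 ≤ R₁ + 1 →
      𝓢.timeOrientation.IsFutureDirected
        (mfderiv 𝓘(ℝ, E4) (𝓡 4) (d.chart i) x (((d.motion i).1 : E4 ≃L[ℝ] E4) (E4.basisVector 0))))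
    (hτs : τ₁ < τs) (hqs : τq ≤ τs) (hTs : T ≤ τs) :
    ∀ x : (d.background i).domain, τs ≤ (d.background i).time x.1 → R₁ ≤ (d.background i).radius x.1 →
      (d.background i).radius x.1 ≤ W (x.1 0) →
      𝓢.timeOrientation.IsFutureDirected
        (mfderiv 𝓘(ℝ, E4) (𝓡 4) Ψg x (((d.motion i).1 : E4 ≃L[ℝ] E4) (E4.basisVector 0))) := by
  set e : E4 := ((d.motion i).1 : E4 ≃L[ℝ] E4) (E4.basisVector 0) with he
  have hUo : IsOpen {x : (d.background i).domain |
      τ₁ < (d.background i).time x.1 ∧ (d.background i).radius x.1 < W (x.1 0) + 1} := isOpen_tube d i τ₁ hWc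
  have hM0 : 0 ≤ d.mass i := (d.mass_pos i).le
  -- (a) inside `R₁ + 1`: `Ψg = Ψᵢ` near the point, so the differentials agree and the anchor applies
  have inner : ∀ x : (d.background i).domain, τs ≤ (d.background i).time x.1 → R₀ ≤ (d.background i).radius x.1 →
      (d.background i).radius x.1 < R₁ + 1 →
      𝓢.timeOrientation.IsFutureDirected (mfderiv 𝓘(ℝ, E4) (𝓡 4) Ψg x e) := by
    intro x hxt hxR hxr
    have hev : Ψg =ᶠ[𝓝 x] d.chart i := by
      have ho : IsOpen {y : (d.background i).domain | (d.background i).radius y.1 < R₁ + 1} :=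
        isOpen_lt ((continuous_background_radius d i).comp continuous_subtype_val) continuous_const
      exact Filter.eventuallyEq_of_mem (ho.mem_nhds hxr) fun y hy ↦ hG2 y (le_of_lt hy)
    have hx' : Ψg x = d.chart i x := hG2 x hxr.le
    have key := hT x (hTs.trans hxt) hxR hxr.le
    rw [hev.mfderiv_eq, hx']
    exact key
  -- (b) differentiability of `Ψg` on the open tube
  have hdiff : ∀ x : (d.background i).domain,
      x ∈ {x : (d.background i).domain |
        τ₁ < (d.background i).time x.1 ∧ (d.background i).radius x.1 < W (x.1 0) + 1} →
      MDifferentiableAt 𝓘(ℝ, E4) (𝓡 4) Ψg x := fun x hx ↦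
    ((hG1 x hx).contMDiffAt (hUo.mem_nhds hx)).mdifferentiableAt (by simp)
  -- (c) timelike axis at every band point from `τq` on
  have timelike : ∀ x : (d.background i).domain, τq ≤ (d.background i).time x.1 →
      R₀ ≤ (d.background i).radius x.1 → (d.background i).radius x.1 ≤ W (x.1 0) →
      𝓢.metric.IsTimelike (mfderiv 𝓘(ℝ, E4) (𝓡 4) Ψg x e) := by
    intro x hxt hxR hxW
    have hsup := hG3q ((d.background i).time x.1) hxt
    have hmem : x ∈ {x' : (d.background i).domain |
        (d.background i).time x'.1 = (d.background i).time x.1 ∧ (d.background i).radius x'.1 ≤ W (x'.1 0)} :=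
      ⟨rfl, hxW⟩
    have h20 : (0 : ℝ) ≤ 1 / (20 * ‖(((d.motion i).1 : E4 ≃L[ℝ] E4) : E4 →L[ℝ] E4)‖ ^ 2) := by positivity
    have hdev := BoostedKerrLegs.norm_deviation_le_of_supCkENorm_le 𝓢 (d.background i) Ψg h20 hsup x hmem
    have hval := BoostedKerrLegs.val_mfderiv_axis_le 𝓢 (d.motion i).1 (d.motion i).2 (d.spin i) hM0 Ψg x
      (hMR.trans hxR) hdev
    rw [← he] at hval
    exact hval.trans_lt (by norm_num)
  -- the claim
  intro x hxt hxR hxW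
  by_cases hxin : (d.background i).radius x.1 < R₁ + 1 / 2
  · exact inner x hxt (hR.trans hxR) (by linarith)
  push Not at hxin
  -- (d) S3a: a preconnected coordinate set inside the band joining `x` to the collar sphere `r = R₁ + ½`
  have hrp : max (Kerr.rPlus (d.mass i) (d.spin i)) 0 < R₁ + 1 / 2 := by
    have h1 : Kerr.rPlus (d.mass i) (d.spin i) ≤ 2 * d.mass i := Kerr.rPlus_le_two_mul hM0
    have h2 : 0 ≤ R₁ := by nlinarith [d.mass_pos i]
    exact max_lt (by linarith) (by linarith)
  obtain ⟨S, hSc, hSB, hxS, hSband, y, hyS, hyr⟩ :=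
    hS3a (d.motion i).1 (d.motion i).2 (d.mass i) (d.spin i) W R₁ τs hv hWm hrp x hxt hxin hxW
  have hSB' : S ⊆ ((d.background i).domain : Set E4) := hSB
  have hSband' : ∀ z ∈ S, τs ≤ (d.background i).time z ∧ R₁ + 1 / 2 ≤ (d.background i).radius z ∧
      (d.background i).radius z ≤ W (z 0) := hSband
  have hyr' : (d.background i).radius y = R₁ + 1 / 2 := hyr
  clear hSB hSband hyr
  -- (e) one sign on `S` for the parametrisation `ψ = Ψg ∘ (chartAt E4 x).symm`
  have hOo : IsOpen (Subtype.val '' {x : (d.background i).domain |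
      τ₁ < (d.background i).time x.1 ∧ (d.background i).radius x.1 < W (x.1 0) + 1}) :=
    (d.background i).domain.2.isOpenMap_subtype_val _ hUo
  have hSO : S ⊆ Subtype.val '' {x : (d.background i).domain |
      τ₁ < (d.background i).time x.1 ∧ (d.background i).radius x.1 < W (x.1 0) + 1} := by
    intro z hz
    obtain ⟨hzt, hzr, hzW⟩ := hSband' z hz
    refine ⟨⟨z, hSB' hz⟩, ⟨?_, ?_⟩, rfl⟩
    · show τ₁ < (d.background i).time z
      exact lt_of_lt_of_le hτs hzt
    · show (d.background i).radius z < W (z 0) + 1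
      linarith
  have hsymm : ∀ (z : E4) (hz : z ∈ ((d.background i).domain : Set E4)), (chartAt E4 x).symm z = ⟨z, hz⟩ :=
    fun z hz ↦ Subtype.ext (OpensChart.chartAt_symm_val x hz)
  have hψ : ContMDiffOn 𝓘(ℝ, E4) (𝓡 4) ∞ (Ψg ∘ (chartAt E4 x).symm)
      (Subtype.val '' {x : (d.background i).domain |
        τ₁ < (d.background i).time x.1 ∧ (d.background i).radius x.1 < W (x.1 0) + 1}) := by
    have hc : ContMDiffOn 𝓘(ℝ, E4) 𝓘(ℝ, E4) ∞ (chartAt E4 x).symm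
        (Subtype.val '' {x : (d.background i).domain |
          τ₁ < (d.background i).time x.1 ∧ (d.background i).radius x.1 < W (x.1 0) + 1}) := by
      have h := contMDiffOn_chart_symm (H := E4) (I := 𝓘(ℝ, E4)) (x := x) (n := ∞)
      rw [OpensChart.chartAt_target] at h
      exact h.mono (by rintro _ ⟨z, _, rfl⟩; exact z.2)
    refine hG1.comp hc ?_
    rintro _ ⟨z, hz, rfl⟩
    rw [Set.mem_preimage, hsymm z.1 z.2]
    exact hz
  have hmemU : ∀ z (hz : z ∈ S), (⟨z, hSB' hz⟩ : (d.background i).domain) ∈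
      {x : (d.background i).domain |
        τ₁ < (d.background i).time x.1 ∧ (d.background i).radius x.1 < W (x.1 0) + 1} := by
    intro z hz
    obtain ⟨hzt, hzr, hzW⟩ := hSband' z hz
    refine ⟨?_, ?_⟩
    · show τ₁ < (d.background i).time z
      exact lt_of_lt_of_le hτs hzt
    · show (d.background i).radius z < W (z 0) + 1
      linarith
  have hd : ∀ z (hz : z ∈ S), mfderiv 𝓘(ℝ, E4) (𝓡 4) (Ψg ∘ (chartAt E4 x).symm) z e =
      mfderiv 𝓘(ℝ, E4) (𝓡 4) Ψg ⟨z, hSB' hz⟩ e := fun z hz ↦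
    𝓢.mfderiv_comp_chartAt_symm_apply (d.background i) Ψg x (hSB' hz) (hdiff _ (hmemU z hz)) _
  have hpt : ∀ z (hz : z ∈ S), (Ψg ∘ (chartAt E4 x).symm) z = Ψg ⟨z, hSB' hz⟩ := by
    intro z hz
    show Ψg ((chartAt E4 x).symm z) = _
    rw [hsymm z (hSB' hz)]
  have hcausal : ∀ z ∈ S, 𝓢.metric.IsCausal (mfderiv 𝓘(ℝ, E4) (𝓡 4) (Ψg ∘ (chartAt E4 x).symm) z e) := by
    intro z hz
    obtain ⟨hzt, hzr, hzW⟩ := hSband' z hz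
    have hzR : R₀ ≤ (d.background i).radius z := by linarith
    have h := (timelike ⟨z, hSB' hz⟩ (hqs.trans hzt) hzR hzW).isCausal
    rw [hd z hz]
    show 𝓢.metric.IsCausal (x := (Ψg ∘ (chartAt E4 x).symm) z) _
    rw [hpt z hz]
    exact h
  -- the anchor point `y` on the collar sphere is future-directed (case (a))
  have hy1 : 𝓢.timeOrientation.IsFutureDirected (mfderiv 𝓘(ℝ, E4) (𝓡 4) (Ψg ∘ (chartAt E4 x).symm) y e) := by
    obtain ⟨hyt, hyR, hyW⟩ := hSband' y hyS
    have hyR₀ : R₀ ≤ (d.background i).radius y := by linarith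
    have hyR₁ : (d.background i).radius y < R₁ + 1 := by linarith
    have h := inner ⟨y, hSB' hyS⟩ hyt hyR₀ hyR₁
    rw [hd y hyS]
    show 𝓢.timeOrientation.IsFutureDirected (x := (Ψg ∘ (chartAt E4 x).symm) y) _
    rw [hpt y hyS]
    exact h
  have key := 𝓢.isFutureDirected_mfderiv_apply_of_isPreconnected hOo hψ hSc hSO (fun _ ↦ e)
    continuousOn_const hcausal hyS hy1 x.1 hxS
  have hxeq : (⟨x.1, hSB' hxS⟩ : (d.background i).domain) = x := Subtype.ext rfl
  rw [hd x.1 hxS] at key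
  have key' : 𝓢.timeOrientation.IsFutureDirected (x := (Ψg ∘ (chartAt E4 x).symm) x.1)
      (mfderiv 𝓘(ℝ, E4) (𝓡 4) Ψg ⟨x.1, hSB' hxS⟩ e) := key
  rw [hpt x.1 hxS, hxeq] at key'
  exact key'

end Glue

/-! ## Self-certified walls (registered helper `cert_of_selfCertified`) -/

/-- **Self-certified walls** (v5 glue; generalises the disprover's §3 `gapCert_of_constWall`): if the INPUT chart `Ψᵢ`
already has `C²` deviation `→ 0` on the sub-wall slabs of some normalised wall `W` dominating `3ρᵢ+2` from `T₀`, then the gap analytic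
certificate for `W` from `T₀` holds with the witness `R₁ = R₀`, `τ₁ = max τ₀ T₀`, `Ψg = Ψᵢ` — (G1) from the STRUCTURE (late-chart
smoothness, open embedding of the late region restricted to the open sub-wall tube, image in the hole region), (G2) `rfl`, (G3) the
hypothesis.  Every eventually BOUNDED excision is self-certified (constant wall `max W₀ (R₀+2)`, fixed-radius `C⁴ → C²` convergence
`tendsto_truncDeviationCk`), so the bounded-tube case of v3/v4 is a special case. [folklore] -/
theorem cert_of_selfCertified {𝓢 : Spacetime.{0} 4} {O : Set 𝓢.carrier} (d : FinalStateDecomposition 𝓢 O 4) (R₀ : ℝ)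
    (i : Fin d.N) {T₀ : ℝ} {W : ℝ → ℝ} (hWc : Continuous W)
    (hG3 : Tendsto (fun τ ↦ supCkENorm (Subtype.val '' {x : (d.background i).domain |
      (d.background i).time x.1 = τ ∧ (d.background i).radius x.1 ≤ W (x.1 0)}) 2
      (𝓢.deviationExtend (d.background i) (d.chart i))) atTop (𝓝 0)) :
    GapAnalyticCert 𝓢 O d R₀ i T₀ W := by
  have hlc := d.isLateChart i
  have hτ₀ : d.τ₀ ≤ max d.τ₀ T₀ := le_max_left _ _
  refine ⟨R₀, max d.τ₀ T₀, d.chart i, le_rfl, le_rfl, ⟨?_, ?_, ?_⟩, fun x _ ↦ rfl, hG3⟩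
  · -- (G1a) smoothness from the structure
    exact hlc.contMDiff.contMDiffOn
  · -- (G1b) the sub-wall late tube is an open subset of the late region; restrict the open embedding
    have hUopen := isOpen_tube d i (max d.τ₀ T₀) hWc
    have hLopen : IsOpen ((d.background i).lateRegion d.τ₀) :=
      isOpen_lt continuous_const ((continuous_background_time d i).comp continuous_subtype_val)
    have hUL : {x : (d.background i).domain | max d.τ₀ T₀ < (d.background i).time x.1 ∧
        (d.background i).radius x.1 < W (x.1 0) + 1} ⊆ (d.background i).lateRegion d.τ₀ :=
      fun x hx ↦ lt_of_le_of_lt hτ₀ hx.1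
    have hι : Topology.IsOpenEmbedding (Set.inclusion hUL) := by
      refine Topology.IsOpenEmbedding.of_comp _ hLopen.isOpenEmbedding_subtypeVal ?_
      exact hUopen.isOpenEmbedding_subtypeVal
    have hcomp : {x : (d.background i).domain | max d.τ₀ T₀ < (d.background i).time x.1 ∧
        (d.background i).radius x.1 < W (x.1 0) + 1}.restrict (d.chart i) =
        ((d.background i).lateRegion d.τ₀).restrict (d.chart i) ∘ Set.inclusion hUL := by
      funext x; rfl
    rw [hcomp]
    exact hlc.isOpenEmbedding.comp hι
  · -- (G1c) image inside the hole region, hence in `d.charted`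
    rintro _ ⟨x, hx, rfl⟩
    exact FinalStateDecomposition.region_subset_charted d i ⟨x, lt_of_le_of_lt hτ₀ hx.1, rfl⟩


end Summit.FinalStateConjecture.FinalStateConjecture.Theorems.NeckGapDecay.ConnectionLevelCones.OfCoreGlue

end
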